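import Mathlib

/-!
# Two-spin block: Hadamard decorrelation of the classical landscape (audit lemmas)

[cite: ImbrieJSP2016, eq. (1.1), eq. (1.3) (assumption LLA), §4.2.1 (block Hamiltonians)]

Basis order `(σ₁,σ₂) = (++), (+−), (−+), (−−)`.  The classical (S^z) landscape of the two-spin block
`H = h₁Z₁ + h₂Z₂ + JZ₁Z₂ + T` extended by a global shift `E₀` is `a = L (E₀,h₁,h₂,J)` with the
Sylvester–Hadamard matrix `L` below.  Since `L Lᵀ = 4·1` (so `|det L| = 16`) the map is a linear
bijection `ℝ⁴ → ℝ⁴`: after adjoining the (spectrally irrelevant) shift `E₀`, the four configuration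
energies become independent coordinates, `|a_σ| ≤ |E₀|+|h₁|+|h₂|+|J|`, and `H = diag(a) + T` is a
rank-ONE Anderson model on four points for which the Combes–Germinet–Klein/Minami estimate applies
with any fixed symmetric `T` [cite: CGK arXiv:0807.0455 Lemma 3.2; Aizenman–Warzel arXiv:0804.4231 (A.n-Minami)].
This is the algebra behind the audit cell's (pub-imbrie, LLA.md gen-7 block O) proof of the
two-site slab-volume bound (V2-int) with constant 896; the last two lemmas are the constant audit.
Audit lemmas only; nothing here asserts or refutes LLA.
-/

namespace Literature.MathematicalPhysics.QuantumLattice.Imbrie2016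

/-- [cite: ImbrieJSP2016, eq. (1.1)] the Sylvester–Hadamard matrix of order 4, rows = configurations
`(++),(+−),(−+),(−−)`, columns = coefficients of `(E₀, h₁, h₂, J)` in `E₀ + h₁σ₁ + h₂σ₂ + Jσ₁σ₂`. -/
theorem twoSpin_hadamard_mul_transpose :
    (!![1, 1, 1, 1; 1, 1, -1, -1; 1, -1, 1, -1; 1, -1, -1, 1] : Matrix (Fin 4) (Fin 4) ℝ) *
      (!![1, 1, 1, 1; 1, 1, -1, -1; 1, -1, 1, -1; 1, -1, -1, 1] : Matrix (Fin 4) (Fin 4) ℝ).transpose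
      = (4 : ℝ) • (1 : Matrix (Fin 4) (Fin 4) ℝ) := by
  ext i j
  fin_cases i <;> fin_cases j <;>
    simp [Matrix.mul_apply, Fin.sum_univ_four]
  all_goals norm_num

/-- [cite: ImbrieJSP2016, eq. (1.1)] `(det L)² = 256`, i.e. `|det L| = 16`: the Jacobian of the
decorrelating change of variables `(E₀,h₁,h₂,J) ↦ (a_σ)_σ`. -/
theorem twoSpin_hadamard_det_sq :
    ((!![1, 1, 1, 1; 1, 1, -1, -1; 1, -1, 1, -1; 1, -1, -1, 1] : Matrix (Fin 4) (Fin 4) ℝ).det) ^ 2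
      = 256 := by
  have h := congrArg Matrix.det twoSpin_hadamard_mul_transpose
  rw [Matrix.det_mul, Matrix.det_transpose, Matrix.det_smul, Matrix.det_one] at h
  simp only [Fintype.card_fin, mul_one] at h
  rw [pow_two, h]
  norm_num

/-- [cite: ImbrieJSP2016, eq. (1.1)] `|det L| = 16`. -/
theorem twoSpin_hadamard_abs_det :
    |((!![1, 1, 1, 1; 1, 1, -1, -1; 1, -1, 1, -1; 1, -1, -1, 1] : Matrix (Fin 4) (Fin 4) ℝ).det)|
      = 16 := by
  have h : ((!![1, 1, 1, 1; 1, 1, -1, -1; 1, -1, 1, -1; 1, -1, -1, 1] :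
      Matrix (Fin 4) (Fin 4) ℝ).det) ^ 2 = (16 : ℝ) ^ 2 := by
    rw [twoSpin_hadamard_det_sq]; norm_num
  have := (sq_eq_sq_iff_abs_eq_abs _ _).mp h
  simpa using this

/-- [cite: ImbrieJSP2016, eq. (1.1)] explicit inverse (`L⁻¹ = Lᵀ/4`): the shift and the three
couplings are recovered from the four configuration energies, so `(E₀,h₁,h₂,J) ↦ a` is a bijection. -/
theorem twoSpin_hadamard_inverse (E₀ h₁ h₂ J : ℝ) :
    let a₁ := E₀ + h₁ + h₂ + J
    let a₂ := E₀ + h₁ - h₂ - J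
    let a₃ := E₀ - h₁ + h₂ - J
    let a₄ := E₀ - h₁ - h₂ + J
    E₀ = (a₁ + a₂ + a₃ + a₄) / 4 ∧ h₁ = (a₁ + a₂ - a₃ - a₄) / 4 ∧
      h₂ = (a₁ - a₂ + a₃ - a₄) / 4 ∧ J = (a₁ - a₂ - a₃ + a₄) / 4 := by
  refine ⟨?_, ?_, ?_, ?_⟩ <;> ring

/-- [cite: ImbrieJSP2016, eq. (1.1)] conversely every landscape `a ∈ ℝ⁴` is attained: surjectivity
of the decorrelating map. -/
theorem twoSpin_hadamard_surjective (a₁ a₂ a₃ a₄ : ℝ) :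
    ∃ E₀ h₁ h₂ J : ℝ, a₁ = E₀ + h₁ + h₂ + J ∧ a₂ = E₀ + h₁ - h₂ - J ∧
      a₃ = E₀ - h₁ + h₂ - J ∧ a₄ = E₀ - h₁ - h₂ + J := by
  refine ⟨(a₁ + a₂ + a₃ + a₄) / 4, (a₁ + a₂ - a₃ - a₄) / 4, (a₁ - a₂ + a₃ - a₄) / 4,
    (a₁ - a₂ - a₃ + a₄) / 4, ?_, ?_, ?_, ?_⟩ <;> ring

/-- [cite: ImbrieJSP2016, eq. (1.1)] the image of the box `[−M,M]⁴` lies in the cube `[−4M,4M]⁴`: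
`|E₀ + h₁σ₁ + h₂σ₂ + Jσ₁σ₂| ≤ |E₀| + |h₁| + |h₂| + |J|` for `σ ∈ {±1}²`. -/
theorem twoSpin_landscape_abs_le (E₀ h₁ h₂ J σ₁ σ₂ : ℝ) (hσ₁ : σ₁ = 1 ∨ σ₁ = -1)
    (hσ₂ : σ₂ = 1 ∨ σ₂ = -1) :
    |E₀ + h₁ * σ₁ + h₂ * σ₂ + J * σ₁ * σ₂| ≤ |E₀| + |h₁| + |h₂| + |J| := by
  have hs₁ : |σ₁| = 1 := by rcases hσ₁ with rfl | rfl <;> simp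
  have hs₂ : |σ₂| = 1 := by rcases hσ₂ with rfl | rfl <;> simp
  calc |E₀ + h₁ * σ₁ + h₂ * σ₂ + J * σ₁ * σ₂|
      ≤ |E₀ + h₁ * σ₁ + h₂ * σ₂| + |J * σ₁ * σ₂| := abs_add_le _ _
    _ ≤ |E₀ + h₁ * σ₁| + |h₂ * σ₂| + |J * σ₁ * σ₂| :=
        add_le_add (abs_add_le _ _) le_rfl
    _ ≤ |E₀| + |h₁ * σ₁| + |h₂ * σ₂| + |J * σ₁ * σ₂| :=
        add_le_add (add_le_add (abs_add_le _ _) le_rfl) le_rfl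
    _ = |E₀| + |h₁| + |h₂| + |J| := by simp [abs_mul, hs₁, hs₂]

/-- [cite: ImbrieJSP2016, eq. (1.3)] gap events are shift invariant: the spectrum-shift `E₀` added to
all configuration energies changes no eigenvalue difference — recorded as the trivial identity it is
(for the ordered levels `E_k(diag(a) + T + E₀·1) = E_k(diag(a)+T) + E₀`). -/
theorem shift_invariance_of_gaps (E E' E₀ : ℝ) : (E + E₀) - (E' + E₀) = E - E' := by ring

/-- [cite: ImbrieJSP2016, eq. (1.3)] the covering count: the intervals `[jη,(j+2)η)`, `j ∈ ℤ`,
`⌊-R/η⌋ ≤ j ≤ ⌊R/η⌋`, used to pass from Minami's second-moment bound to the minimal-gap event,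
number at most `2R/η + 2` (`⌊x⌋ - ⌊-x⌋ ≤ 2x + 1`). -/
theorem covering_count_le (x : ℝ) :
    ((⌊x⌋ - ⌊-x⌋ + 1 : ℤ) : ℝ) ≤ 2 * x + 2 := by
  have h1 : ((⌊x⌋ : ℤ) : ℝ) ≤ x := Int.floor_le x
  have h2 : (-x : ℝ) < ((⌊-x⌋ : ℤ) : ℝ) + 1 := Int.lt_floor_add_one (-x)
  push_cast
  linarith

/-- [cite: ImbrieJSP2016, eq. (1.3)] constant audit of (V2-int): with `R' = 4M + ‖T‖ ≤ 4M + 2`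
(`‖t₁X₁+t₂X₂‖ = |t₁|+|t₂| ≤ 2`), the bound `128·M·((4M+2)η + η²)` is at most `896·η·M²` in the
range `1 ≤ M`, `0 < η ≤ M`. -/
theorem v2int_constant_audit (M η : ℝ) (hM : 1 ≤ M) (hη : 0 < η) (hηM : η ≤ M) :
    128 * M * ((4 * M + 2) * η + η ^ 2) ≤ 896 * η * M ^ 2 := by
  nlinarith [mul_pos (by linarith : (0:ℝ) < M) hη, mul_le_mul_of_nonneg_left hηM hη.le,
    mul_le_mul_of_nonneg_left hM (by positivity : (0:ℝ) ≤ M * η)]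

/-- [cite: ImbrieJSP2016, eq. (1.3)] constant audit, trivial range: for `η ≥ M ≥ 1` the whole box
`[−M,M]³` has volume `8M³ ≤ 8ηM² ≤ 896ηM²`. -/
theorem v2int_constant_audit_trivial (M η : ℝ) (hM : 1 ≤ M) (hηM : M ≤ η) :
    (2 * M) ^ 3 ≤ 896 * η * M ^ 2 := by
  nlinarith [mul_le_mul_of_nonneg_left hηM (by positivity : (0:ℝ) ≤ M ^ 2),
    pow_pos (by linarith : (0:ℝ) < M) 2]

/-- [cite: ImbrieJSP2016, eq. (1.3)] Markov step of the Minami bound: for a natural number `X`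
(eigenvalue count in an interval), `𝟙{X ≥ 2} ≤ X(X−1)/2`. -/
theorem indicator_two_le_choose (X : ℕ) (hX : 2 ≤ X) : (1 : ℝ) ≤ (X : ℝ) * ((X : ℝ) - 1) / 2 := by
  have : (2 : ℝ) ≤ X := by exact_mod_cast hX
  nlinarith

/-- [cite: ImbrieJSP2016, eq. (1.3)] and for the rank-`m` (extended Minami) step used at three
spins: `𝟙{X ≥ m+1} ≤ X/(m+1)`. -/
theorem indicator_succ_le_div (X m : ℕ) (hX : m + 1 ≤ X) : (1 : ℝ) ≤ (X : ℝ) / (m + 1) := by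
  rw [le_div_iff₀ (by positivity), one_mul]
  exact_mod_cast hX

end Literature.MathematicalPhysics.QuantumLattice.Imbrie2016
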